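import Summits.AtomisticToContinuum.Crystallization.Theorems.ExcessDecayLiouvillePhononStabilityCertChart
import Summits.AtomisticToContinuum.Crystallization.Theorems.ExcessDecayLiouvillePhononStabilityCertWindow

/-!
# Near-certificate layer XI: the window inside the root chart box

Support file for crux `PhononStability` (stmt-AtomisticToContinuum-9333), line `contragredient-window-collapse`
(lead c2).  Every window datum `(A, δ)` (`CellWindow A`, `ShiftWindow A δ`) has chart coordinates
`x = chartX C₀ A B δ` (root cell `C₀`: centre `Ĝ_c = m·M₀` with `m = (a² + b²)/2`, `a = 189/200`, `b = 199/200`,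
zero shift) in an explicit rational box `|x_v| ≤ rootH v`, `v = 1 … 15`:

* strain variables `v ≤ 6`: from the bilinear window bound `|⟪Ax, Ay⟫ − m⟪x, y⟫| ≤ ε ‖x‖ ‖y‖`, `ε = (b² − a²)/2`
  (polarization + scaling), applied to the generator pairs defining the chart;
* shift variables `7, 8, 9`: `…CertWindow.chart_shiftBox`;
* inter-bond lengths `10 … 15`: `…CertChart.abs_rho_sub_le` (geometric radius `hGeom 36 m`).

[folklore]
-/

noncomputable section

open scoped BigOperators Classical InnerProductSpace
open Filter Set Function
open Summit.AtomisticToContinuum.Crystallization.Theorems.PhononStabilityNegative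

namespace Summit.AtomisticToContinuum.Crystallization.Theorems.PhononStabilityCWC.Cert

local notation "E3" => EuclideanSpace ℝ (Fin 3)

/-! ## The bilinear window bound -/

/-- `a² ‖x‖² ≤ ‖A x‖² ≤ b² ‖x‖²` on the cell window. [folklore] -/
theorem norm_sq_window {A : E3 →L[ℝ] E3} (hW : CellWindow A) (x : E3) :
    (189 / 200) ^ 2 * ‖x‖ ^ 2 ≤ ‖A x‖ ^ 2 ∧ ‖A x‖ ^ 2 ≤ (199 / 200) ^ 2 * ‖x‖ ^ 2 := by
  obtain ⟨h1, h2⟩ := hW x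
  have h0 : 0 ≤ ‖x‖ := norm_nonneg x
  constructor
  · nlinarith [pow_le_pow_left₀ (by positivity) h1 2]
  · nlinarith [pow_le_pow_left₀ (norm_nonneg _) h2 2]

/-- the centre value `m = (a² + b²)/2` and the radius `ε = (b² − a²)/2` of the window in the squared metric -/
def mWin : ℚ := ((189 / 200) ^ 2 + (199 / 200) ^ 2) / 2
/-- the radius `ε = (b² − a²)/2` -/
def eWin : ℚ := ((199 / 200 : ℚ) ^ 2 - (189 / 200) ^ 2) / 2

/-- the quadratic window bound around the centre: `|‖Ax‖² − m‖x‖²| ≤ ε‖x‖²`. [folklore] -/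
theorem abs_norm_sq_sub_le {A : E3 →L[ℝ] E3} (hW : CellWindow A) (x : E3) :
    |‖A x‖ ^ 2 - mWin * ‖x‖ ^ 2| ≤ eWin * ‖x‖ ^ 2 := by
  obtain ⟨h1, h2⟩ := norm_sq_window hW x
  unfold mWin eWin
  push_cast
  rw [abs_le]
  constructor <;> nlinarith

/-- **the bilinear window bound:** `|⟪Ax, Ay⟫ − m⟪x, y⟫| ≤ ε ‖x‖ ‖y‖`. [folklore] -/
theorem abs_inner_sub_le {A : E3 →L[ℝ] E3} (hW : CellWindow A) (x y : E3) :
    |inner ℝ (A x) (A y) - mWin * inner ℝ x y| ≤ eWin * (‖x‖ * ‖y‖) := by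
  -- polarization on the rescaled pair (t x, t⁻¹ y) is avoided: we prove the `(ε/2)(‖x‖²+‖y‖²)` form for all pairs
  -- and apply it to `(s • x, s⁻¹ • y)` with `s² = ‖y‖/‖x‖`.
  have half : ∀ u v : E3, |inner ℝ (A u) (A v) - mWin * inner ℝ u v| ≤ eWin / 2 * (‖u‖ ^ 2 + ‖v‖ ^ 2) := by
    intro u v
    have hp := abs_norm_sq_sub_le hW (u + v)
    have hm := abs_norm_sq_sub_le hW (u - v)
    have e1 : inner ℝ (A u) (A v) = (‖A (u + v)‖ ^ 2 - ‖A (u - v)‖ ^ 2) / 4 := by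
      rw [map_add, map_sub, @norm_add_sq_real, @norm_sub_sq_real]; ring
    have e2 : inner ℝ u v = (‖u + v‖ ^ 2 - ‖u - v‖ ^ 2) / 4 := by
      rw [@norm_add_sq_real, @norm_sub_sq_real]; ring
    have e3 : ‖u + v‖ ^ 2 + ‖u - v‖ ^ 2 = 2 * (‖u‖ ^ 2 + ‖v‖ ^ 2) := by
      rw [@norm_add_sq_real, @norm_sub_sq_real]; ring
    rw [e1, e2, abs_le]
    rw [abs_le] at hp hm
    unfold mWin eWin at hp hm ⊢
    push_cast at hp hm ⊢
    constructor <;> nlinarith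
  by_cases hx : x = 0
  · subst hx; simp
  by_cases hy : y = 0
  · subst hy; simp
  have hxp : 0 < ‖x‖ := norm_pos_iff.mpr hx
  have hyp : 0 < ‖y‖ := norm_pos_iff.mpr hy
  set s : ℝ := Real.sqrt (‖y‖ / ‖x‖) with hs
  have hs0 : 0 < s := Real.sqrt_pos.mpr (div_pos hyp hxp)
  have hs2 : s ^ 2 = ‖y‖ / ‖x‖ := Real.sq_sqrt (div_pos hyp hxp).le
  have h := half (s • x) (s⁻¹ • y)
  rw [map_smul, map_smul, real_inner_smul_left, real_inner_smul_right, real_inner_smul_left, real_inner_smul_right,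
    norm_smul, norm_smul, Real.norm_eq_abs, Real.norm_eq_abs, abs_of_pos hs0, abs_of_pos (inv_pos.mpr hs0)] at h
  have hss : s * s⁻¹ = 1 := mul_inv_cancel₀ hs0.ne'
  have e4 : s * (s⁻¹ * inner ℝ (A x) (A y)) = inner ℝ (A x) (A y) := by rw [← mul_assoc, hss, one_mul]
  have e5 : s * (s⁻¹ * inner ℝ x y) = inner ℝ x y := by rw [← mul_assoc, hss, one_mul]
  rw [e4, e5] at h
  have e6 : (s * ‖x‖) ^ 2 + (s⁻¹ * ‖y‖) ^ 2 = 2 * (‖x‖ * ‖y‖) := by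
    have hsi : (s⁻¹) ^ 2 = ‖x‖ / ‖y‖ := by rw [inv_pow, hs2, inv_div]
    rw [mul_pow, mul_pow, hs2, hsi]
    field_simp
    ring
  rw [e6] at h
  unfold eWin at h ⊢
  push_cast at h ⊢
  linarith

/-! ## The root cell and its box -/

/-- the Gram matrix `M₀ = (⟪genᵢ, genⱼ⟫)` of the generators -/
def M0Q : Mat := fun i j =>
  match i, j with
  | 0, 0 => 1 | 0, 1 => 1 / 2 | 1, 0 => 1 / 2 | 1, 1 => 1 | 2, 2 => 8 / 3 | _, _ => 0

/-- `⟪genᵢ, genⱼ⟫ = M₀ᵢⱼ`. [folklore] -/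
theorem inner_gen (i j : Fin 3) : inner ℝ (gen i) (gen j) = (M0Q i j : ℝ) := by
  obtain ⟨⟨a0, a1, a2⟩, ⟨b0, b1, b2⟩, ⟨c0, c1, c2⟩⟩ := gen_apply
  have h3 : (√3 : ℝ) ^ 2 = 3 := Real.sq_sqrt (by norm_num)
  have h23 : (√(2 / 3) : ℝ) ^ 2 = 2 / 3 := Real.sq_sqrt (by norm_num)
  rw [inner_fin3]
  fin_cases i <;> fin_cases j <;>
    simp only [Fin.zero_eta, Fin.mk_one, Fin.reduceFinMk, a0, a1, a2, b0, b1, b2, c0, c1, c2, M0Q] <;> push_cast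
  · ring
  · ring
  · ring
  · ring
  · linear_combination (1 / 4 : ℝ) * h3
  · ring
  · ring
  · ring
  · linear_combination (4 : ℝ) * h23

/-- **the root cell** `C₀`: centre `Ĝ_c = m · M₀`, zero shift. -/
def rootCell : CellData := ⟨fun i j => mWin * M0Q i j, fun _ => 0, fun i j => M0inv i j / mWin⟩

/-- the centre of the root cell is `m · M₀` (symmetric access). [folklore] -/
theorem rootCell_G (i j : Fin 3) : rootCell.G i j = mWin * M0Q i j := by
  unfold CellData.G rootCell
  fin_cases i <;> fin_cases j <;> simp [M0Q]

/-- `Ĝᵢⱼ − m M₀ᵢⱼ = ⟪A genᵢ, A genⱼ⟫ − m ⟪genᵢ, genⱼ⟫`. [folklore] -/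
theorem ghat_sub_rootG (A : E3 →L[ℝ] E3) (i j : Fin 3) :
    ghat A i j - rootCell.G i j = inner ℝ (A (gen i)) (A (gen j)) - mWin * inner ℝ (gen i) (gen j) := by
  rw [rootCell_G, ghat, inner_gen]; push_cast; ring

/-- a linear combination of generators and the bilinear window bound for it. [folklore] -/
theorem abs_combo_le {A : E3 →L[ℝ] E3} (hW : CellWindow A) (p q : Fin 3 → ℝ) :
    |∑ i, ∑ j, p i * (ghat A i j - rootCell.G i j) * q j| ≤
      eWin * (‖∑ i, p i • gen i‖ * ‖∑ j, q j • gen j‖) := by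
  have h := abs_inner_sub_le hW (∑ i, p i • gen i) (∑ j, q j • gen j)
  have e : inner ℝ (A (∑ i, p i • gen i)) (A (∑ j, q j • gen j)) - mWin * inner ℝ (∑ i, p i • gen i) (∑ j, q j • gen j)
      = ∑ i, ∑ j, p i * (ghat A i j - rootCell.G i j) * q j := by
    simp only [map_sum, map_smul]
    rw [sum_inner, sum_inner, Finset.mul_sum, ← Finset.sum_sub_distrib]
    refine Finset.sum_congr rfl fun i _ => ?_
    rw [inner_sum, inner_sum, Finset.mul_sum, ← Finset.sum_sub_distrib]
    refine Finset.sum_congr rfl fun j _ => ?_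
    rw [real_inner_smul_left, real_inner_smul_right, real_inner_smul_left, real_inner_smul_right, ghat_sub_rootG]
    ring
  rwa [e] at h

/-- `‖Σ pᵢ genᵢ‖² = pᵀ M₀ p`. [folklore] -/
theorem norm_sq_combo (p : Fin 3 → ℝ) : ‖∑ i, p i • gen i‖ ^ 2 = ∑ i, ∑ j, p i * (M0Q i j : ℝ) * p j := by
  rw [← real_inner_self_eq_norm_sq, sum_inner]
  refine Finset.sum_congr rfl fun i _ => ?_
  rw [inner_sum]
  refine Finset.sum_congr rfl fun j _ => ?_
  rw [real_inner_smul_left, real_inner_smul_right, inner_gen]; ring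

/-- norm bound of a combination from a rational bound of `pᵀ M₀ p`. [folklore] -/
theorem norm_combo_le (p : Fin 3 → ℝ) {r : ℝ} (hr : 0 ≤ r) (h : ∑ i, ∑ j, p i * (M0Q i j : ℝ) * p j ≤ r ^ 2) :
    ‖∑ i, p i • gen i‖ ≤ r := by
  rw [← norm_sq_combo] at h
  exact (pow_le_pow_iff_left₀ (norm_nonneg _) hr two_ne_zero).mp h

/-- **strain-variable bound:** `|Σ pᵢ Xᵢⱼ qⱼ| ≤ ε r_p r_q` from rational norm bounds. [folklore] -/
theorem abs_combo_le' {A : E3 →L[ℝ] E3} (hW : CellWindow A) (p q : Fin 3 → ℝ) {rp rq : ℝ} (hrp : 0 ≤ rp)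
    (hrq : 0 ≤ rq) (hp : ∑ i, ∑ j, p i * (M0Q i j : ℝ) * p j ≤ rp ^ 2)
    (hq : ∑ i, ∑ j, q i * (M0Q i j : ℝ) * q j ≤ rq ^ 2) :
    |∑ i, ∑ j, p i * (ghat A i j - rootCell.G i j) * q j| ≤ eWin * (rp * rq) := by
  refine (abs_combo_le hW p q).trans (mul_le_mul_of_nonneg_left ?_ (by unfold eWin; norm_num))
  exact mul_le_mul (norm_combo_le p hrp hp) (norm_combo_le q hrq hq) (norm_nonneg _) hrp

/-! ## The root box -/

/-- half-widths of the root box -/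
def rootH (v : ℕ) : ℚ :=
  if v = 1 ∨ v = 2 ∨ v = 3 then eWin
  else if v = 4 then eWin * (10003 / 10000)
  else if v = 5 then eWin * (99 / 100) * (10003 / 10000)
  else if v = 6 then eWin * (10003 / 10000) ^ 2
  else if v = 7 ∨ v = 8 then 306 / 10000
  else if v = 9 then 163 / 10000
  else hGeom 36 mWin

/-- the shift centre of the root cell vanishes. [folklore] -/
theorem rootCell_dc (i : Fin 3) : rootCell.dc i = 0 := rfl

/-- the centre value of every inter nearest-neighbour bond in the root cell is `m`. [folklore] -/
theorem rootCell_rhoc_inter (k : Fin 6) : rootCell.rhoc (interCls k) = mWin := by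
  fin_cases k <;>
    simp [CellData.rhoc, CellData.zbar, rootCell_G, rootCell_dc, M0Q, zhat0, zhat0.subSignQ, sdiff, iota, interCls,
      Fin.sum_univ_three] <;> ring

section RootBox

variable {A B : E3 →L[ℝ] E3} {δ : E3} (hW : CellWindow A) (hδ : ShiftWindow A δ)
include hW

/-- `x₁, x₂, x₃`. [folklore] -/
theorem root_box_123 :
    |chartX rootCell A B δ 1| ≤ eWin ∧ |chartX rootCell A B δ 2| ≤ eWin ∧ |chartX rootCell A B δ 3| ≤ eWin := by
  have e1 : chartX rootCell A B δ 1 = ghat A 0 0 - rootCell.G 0 0 := by simp [chartX]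
  have e2 : chartX rootCell A B δ 2 = ghat A 1 1 - rootCell.G 1 1 := by simp [chartX]
  have e3 : chartX rootCell A B δ 3 =
      (ghat A 0 0 - rootCell.G 0 0) + (ghat A 1 1 - rootCell.G 1 1) - 2 * (ghat A 0 1 - rootCell.G 0 1) := by
    simp [chartX]
  have s01 : ghat A 1 0 - rootCell.G 1 0 = ghat A 0 1 - rootCell.G 0 1 := by
    rw [ghat_symm A 1 0, CellData.G_symm rootCell 1 0]
  refine ⟨?_, ?_, ?_⟩
  · have h := abs_combo_le' hW ![1, 0, 0] ![1, 0, 0] zero_le_one zero_le_one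
      (by simp [Fin.sum_univ_three, M0Q]) (by simp [Fin.sum_univ_three, M0Q])
    rw [e1]; simpa [Fin.sum_univ_three] using h
  · have h := abs_combo_le' hW ![0, 1, 0] ![0, 1, 0] zero_le_one zero_le_one
      (by simp [Fin.sum_univ_three, M0Q]) (by simp [Fin.sum_univ_three, M0Q])
    rw [e2]; simpa [Fin.sum_univ_three] using h
  · have h := abs_combo_le' hW ![1, -1, 0] ![1, -1, 0] zero_le_one zero_le_one
      (by simp [Fin.sum_univ_three, M0Q]; norm_num) (by simp [Fin.sum_univ_three, M0Q]; norm_num)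
    rw [e3]
    have : ∑ i, ∑ j, (![1, -1, 0] : Fin 3 → ℝ) i * (ghat A i j - rootCell.G i j) * (![1, -1, 0] : Fin 3 → ℝ) j =
        (ghat A 0 0 - rootCell.G 0 0) + (ghat A 1 1 - rootCell.G 1 1) - 2 * (ghat A 0 1 - rootCell.G 0 1) := by
      simp [Fin.sum_univ_three, s01]; ring
    rw [this] at h
    simpa using h

/-- `x₄, x₅, x₆`. [folklore] -/
theorem root_box_456 :
    |chartX rootCell A B δ 4| ≤ eWin * (10003 / 10000) ∧
      |chartX rootCell A B δ 5| ≤ eWin * (99 / 100) * (10003 / 10000) ∧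
        |chartX rootCell A B δ 6| ≤ eWin * (10003 / 10000) ^ 2 := by
  have e4 : chartX rootCell A B δ 4 = 49 / 80 * (ghat A 0 2 - rootCell.G 0 2) := by simp [chartX]
  have e5 : chartX rootCell A B δ 5 =
      49 / 80 * (-(4 / 7) * (ghat A 0 2 - rootCell.G 0 2) + 8 / 7 * (ghat A 1 2 - rootCell.G 1 2)) := by
    simp [chartX]
  have e6 : chartX rootCell A B δ 6 = (49 / 80) ^ 2 * (ghat A 2 2 - rootCell.G 2 2) := by simp [chartX]
  have hq : ∑ i, ∑ j, (![0, 0, 49 / 80] : Fin 3 → ℝ) i * (M0Q i j : ℝ) * (![0, 0, 49 / 80] : Fin 3 → ℝ) j ≤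
      (10003 / 10000 : ℝ) ^ 2 := by
    simp [Fin.sum_univ_three, M0Q]; norm_num
  have hpos : (0 : ℝ) ≤ 10003 / 10000 := by norm_num
  refine ⟨?_, ?_, ?_⟩
  · have h := abs_combo_le' hW ![1, 0, 0] ![0, 0, 49 / 80] zero_le_one hpos (by simp [Fin.sum_univ_three, M0Q]) hq
    rw [e4]
    have : ∑ i, ∑ j, (![1, 0, 0] : Fin 3 → ℝ) i * (ghat A i j - rootCell.G i j) * (![0, 0, 49 / 80] : Fin 3 → ℝ) j =
        49 / 80 * (ghat A 0 2 - rootCell.G 0 2) := by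
      simp [Fin.sum_univ_three]; ring
    rw [this] at h
    simpa using h
  · have hp : ∑ i, ∑ j, (![-(4 / 7), 8 / 7, 0] : Fin 3 → ℝ) i * (M0Q i j : ℝ) * (![-(4 / 7), 8 / 7, 0] : Fin 3 → ℝ) j ≤
        (99 / 100 : ℝ) ^ 2 := by
      simp [Fin.sum_univ_three, M0Q]; norm_num
    have h := abs_combo_le' hW ![-(4 / 7), 8 / 7, 0] ![0, 0, 49 / 80] (by norm_num) hpos hp hq
    rw [e5]
    have : ∑ i, ∑ j, (![-(4 / 7), 8 / 7, 0] : Fin 3 → ℝ) i * (ghat A i j - rootCell.G i j) *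
        (![0, 0, 49 / 80] : Fin 3 → ℝ) j =
        49 / 80 * (-(4 / 7) * (ghat A 0 2 - rootCell.G 0 2) + 8 / 7 * (ghat A 1 2 - rootCell.G 1 2)) := by
      simp [Fin.sum_univ_three]; ring
    rw [this] at h
    have e : (eWin : ℝ) * (99 / 100 * (10003 / 10000)) = eWin * (99 / 100) * (10003 / 10000) := by ring
    rw [e] at h
    exact h
  · have h := abs_combo_le' hW ![0, 0, 49 / 80] ![0, 0, 49 / 80] hpos hpos hq hq
    rw [e6]
    have : ∑ i, ∑ j, (![0, 0, 49 / 80] : Fin 3 → ℝ) i * (ghat A i j - rootCell.G i j) * (![0, 0, 49 / 80] : Fin 3 → ℝ) j =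
        (49 / 80) ^ 2 * (ghat A 2 2 - rootCell.G 2 2) := by
      simp [Fin.sum_univ_three]; ring
    rw [this] at h
    have e : (eWin : ℝ) * (10003 / 10000 * (10003 / 10000)) = eWin * (10003 / 10000) ^ 2 := by ring
    rw [e] at h
    exact h

include hδ

/-- `x₇, x₈, x₉`. [folklore] -/
theorem root_box_789 :
    |chartX rootCell A B δ 7| ≤ 306 / 10000 ∧ |chartX rootCell A B δ 8| ≤ 306 / 10000 ∧
      |chartX rootCell A B δ 9| ≤ 163 / 10000 := by
  have e7 : chartX rootCell A B δ 7 = contraOf δ 0 := by simp [chartX, rootCell]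
  have e8 : chartX rootCell A B δ 8 = contraOf δ 1 := by simp [chartX, rootCell]
  have e9 : chartX rootCell A B δ 9 = contraOf δ 2 := by simp [chartX, rootCell]
  obtain ⟨⟨m00, -, -⟩, ⟨-, m11, -⟩, ⟨-, -, m22⟩⟩ := M0inv_val
  have h0 := chart_shiftBox A δ hW hδ 0
  have h1 := chart_shiftBox A δ hW hδ 1
  have h2 := chart_shiftBox A δ hW hδ 2
  rw [m00] at h0; rw [m11] at h1; rw [m22] at h2
  push_cast at h0 h1 h2
  rw [e7, e8, e9]
  refine ⟨?_, ?_, ?_⟩ <;> rw [abs_le] <;> constructor <;> nlinarith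

/-- `x₁₀ … x₁₅`. [folklore] -/
theorem root_box_inter (k : Fin 6) : |chartX rootCell A B δ (10 + k.val)| ≤ hGeom 36 mWin := by
  have e : chartX rootCell A B δ (10 + k.val) = ‖A (bondVec δ (interCls k))‖ ^ 2 - rootCell.rhoc (interCls k) := by
    fin_cases k <;> simp [chartX]
  rw [e, rootCell_rhoc_inter]
  have hQ : Qint (interCls k) = 36 := by fin_cases k <;> rfl
  have h := abs_rho_sub_le hW hδ (interCls k) (by rw [hQ]) mWin
  rwa [hQ] at h

/-- **THE ROOT BOX:** every window datum has chart coordinates in the box `|x_v| ≤ rootH v` (`v = 1 … 15`). -/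
theorem root_box (v : ℕ) (hv1 : 1 ≤ v) (hv2 : v ≤ 15) : |chartX rootCell A B δ v| ≤ rootH v := by
  obtain ⟨a1, a2, a3⟩ := root_box_123 (B := B) (δ := δ) hW
  obtain ⟨a4, a5, a6⟩ := root_box_456 (B := B) (δ := δ) hW
  obtain ⟨a7, a8, a9⟩ := root_box_789 (B := B) hW hδ
  have a10 := root_box_inter (B := B) hW hδ
  interval_cases v
  · simpa [rootH] using a1
  · simpa [rootH] using a2
  · simpa [rootH] using a3
  · simpa [rootH] using a4
  · simpa [rootH] using a5
  · simpa [rootH] using a6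
  · norm_num [rootH]; linarith
  · norm_num [rootH]; linarith
  · norm_num [rootH]; linarith
  · simpa [rootH] using a10 0
  · simpa [rootH] using a10 1
  · simpa [rootH] using a10 2
  · simpa [rootH] using a10 3
  · simpa [rootH] using a10 4
  · simpa [rootH] using a10 5

end RootBox

/-- Anchor of this support file (registered stub of the line skeleton, lead c2). -/
theorem stub_certCover : ∀ (A : EuclideanSpace ℝ (Fin 3) →L[ℝ] EuclideanSpace ℝ (Fin 3)), CellWindow A → ∀ x y : EuclideanSpace ℝ (Fin 3),
    |inner ℝ (A x) (A y) - ((((189 / 200) ^ 2 + (199 / 200) ^ 2) / 2 : ℚ) : ℝ) * inner ℝ x y| ≤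
      ((((199 / 200 : ℚ) ^ 2 - (189 / 200) ^ 2) / 2 : ℚ) : ℝ) * (‖x‖ * ‖y‖) :=
  fun _ hW x y => abs_inner_sub_le hW x y

end Summit.AtomisticToContinuum.Crystallization.Theorems.PhononStabilityCWC.Cert

end
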